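import Summits.BirchSwinnertonDyer.Rank1Residual.Ordinary.Conjectures.KuriharaExactOrderRankOneAt3
import HarnessLib

/-!
# The reciprocity skeleton of the rank-one per-level depth law: `ord_p` of products and of perfect
# pairings on `ℤ/p^n`, and C-16's reading `min(k, F + 2·v_ℓ(P))` DERIVED from the inputs of
# `R1-DEPTH-LAW.md` §2 taken as HYPOTHESES on elements of `ℤ/p^n` (theorems only; no definition, no
# named fact, nothing asserted about any curve; C-16 stays a CONJECTURE)

HONEST FRAMING (cell `b2b-bsdres`, run/shared/lean/b2b/bsd-rank1-residual/, verbatim in every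
file): the goal of the cell is to DELETE the COMBINATION-SHAPED residual classes of the
Birch–Swinnerton-Dyer formula for ALL analytic-rank `≤ 1` elliptic curves over `ℚ` — "full BSD
formula for every rank `≤ 1` curve in class `C`" assembled STRICTLY from published theorems — so
that the rank-`≤ 1` remainder becomes exactly the CONSTRUCTION-SHAPED classes, which are TYPED
(missing-input `Prop`s), NOT attempted. This is not "finishing BSD". Seat `b2b-bsdres-additive-p3`
(X8 prover B / X7 joint; typer-designate for the cell conjecture C-16 = hyp C120.1 by hyp R-16 (e)).
This file books nothing and moves no mark; X7 / X8 stay CONSTRUCTION-SHAPED; C-16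
(`Ordinary/Conjectures/KuriharaExactOrderRankOneAt3.lean`) stays an OPEN CONJECTURE — here its per-level
predicate `KuriharaExactOrderAt` appears only as the CONCLUSION of an implication whose hypotheses are the
named inputs of its heuristic derivation, none of which is asserted.

## What is formalised, and what is not

`HOME/b2b-bsdres-additive-p3/R1-DEPTH-LAW.md` §2 derives LAW-2 `ord_p(δ̃_ℓ mod p^k) = min(k, FLOOR + 2·v_ℓ(P))`
in four steps: (i) `κ₁ = p^a·u·P` with `a = m_p + FLOOR` (Kato's Kolyvagin system; Mazur–Rubin Thm. 5.2.12);
(ii) the Kolyvagin-system axiom at `ℓ` transports `loc_ℓ κ₁`, of divisibility exponent `min(k′, a + v)` in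
`H¹_f(ℚ_ℓ, W) = Ẽ(𝔽_ℓ)/p^{k′} ≅ ℤ/p^{k′}`, to the singular part of `κ_ℓ` at `ℓ`; (iii) GLOBAL RECIPROCITY
for `κ_ℓ ∪ P` (`Σ_w inv_w = 0`, only `w = ℓ` and `w = p` contribute), with the local cup products at `ℓ` and
at `p` PERFECT pairings between rank-one free `ℤ/p^{k′}`-modules, `P̄` of exponent `v` at `ℓ` and `min(k′, m_p)`
at `p`; (iv) Kim 2022 Thm. 3.13: `ord_p δ̃_ℓ = ord loc^s_p κ_ℓ − t`, `t = 0` at a good non-anomalous `p`.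
The Galois-cohomological CONTENT of (i)–(iv) (Kato, Mazur–Rubin, local Tate duality, the Brauer group of `ℚ`,
Kim) is not in the tree and is NOT formalised here. What IS formalised is everything else: once generators
of the four cyclic modules `H¹_s(ℚ_ℓ,W)`, `H¹_f(ℚ_ℓ,W)`, `H¹_s(ℚ_p,W)`, `H¹_f(ℚ_p,W)` are chosen, each input is
a statement about `ord_p` (`zmodPowOrd`, the typed vocabulary of C-16) of an element of `ℤ/p^n` (`n = k′`)
or about a biadditive pairing `ℤ/p^n × ℤ/p^n → ℤ/p^n` with unit value at `(1,1)` (§2: this IS perfectness),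
and step (iii) plus the book-keeping of §2's last paragraph is ARITHMETIC IN `ℤ/p^n`, proved below without
any hypothesis on `p` beyond primality. The two local exponents that enter — `v = v_ℓ(P)` on `Ẽ(𝔽_ℓ)/p^n`
and `min(n, m_p)` on `E(ℚ_p)/p^n` — are themselves kernel theorems of the sibling files
`Ordinary/CyclicSylowClassExponent.lean` and `Ordinary/LocalPointsModPrimePower.lean`.

## Contents

* §1 `ord_p` arithmetic on `ℤ/p^n` (extends `KuriharaExactOrderVocabulary` §2–§3): `zmodPowOrd_natCast_pow`
  (`ord_p(p^a) = min(n, a)`), **`zmodPowOrd_mul`** (`ord_p(x·y) = min(n, ord_p x + ord_p y)`), `zmodPowOrd_neg`.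
* §2 biadditive pairings `B : ℤ/p^n × ℤ/p^n → ℤ/p^n`: `biadditive_apply_eq` (`B(x,y) = x·y·B(1,1)`),
  `isUnit_apply_one_iff_nondegenerate` (`B(1,1)` is a unit ⟺ `B` is left-non-degenerate, `n ≥ 1` — the
  meaning of "perfect" used below), `zmodPowOrd_biadditive` (`ord_p B(x,y) = min(n, ord_p x + ord_p y)`).
* §3 THE SKELETON `min_eq_min_of_reciprocity`: from `ord xl = min(n, a + v)` (κ_ℓ's singular part at `ℓ`),
  `ord yl = min(n, v)` (`P̄` at `ℓ`), `ord yp = min(n, m)` (`P` at `p`), two perfect pairings and the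
  reciprocity relation `Bl(xl, yl) + Bp(xp, yp) = 0`: **`min(n, a + 2v) = min(n, s + m)`**, `s := ord xp`
  (the singular order of `κ_ℓ` at `p`). WHY TWO: `v` enters once in `xl` and once in `yl`.
* §4 with the Mazur–Rubin input `a = m + F`: `singularOrder_eq_of_lt` (`m + F + 2v < n ⇒ s = F + 2v`),
  `min_singularOrder_eq_of_index_zero` (`m = 0 ⇒ min(k, s) = min(k, F + 2v)` for every `k ≤ n`, also in
  `castHom` form), `singularOrder_dichotomy` (`s = F + 2v`, or else `n ≤ m + F + 2v` and `n ≤ s + m`), and the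
  unconditional bound `min(n, m + F + 2v) ≤ s + m` — exactly R1-DEPTH-LAW §2's "DERIVED when `m_p = 0` or
  `FLOOR + m_p + 2v < k′`; outside that regime `ord ≥ k′ − m_p` only".
* §5 the consumer `kuriharaExactOrderAt_of_reciprocitySkeleton`: if for every surjective family of discrete
  logarithms `ψ` there are skeleton data at some depth `n ≥ k` with `v = localDivExponent W 3 ℓ P`,
  `a = m + F`, `m = 0 ∨ m + F + 2v < n`, and the Kim-3.13-shaped identification
  `ord₃(δ̃ mod 3^k) = min(k, s)`, then `KuriharaExactOrderAt W f ℓ k P F` — C-16's clause at `(ℓ, k)` from its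
  derivation's inputs as hypotheses. Nothing is asserted: the hypotheses are exactly what the missing
  cohomological layer would have to supply, per level.

Searched before writing (`lean search`): no `zmodPowOrd_mul` / `_neg` / `_natCast_pow`, no lemma on
biadditive maps `ZMod q →+ ZMod q →+ ZMod q` in Mathlib or the tree; Mathlib's `ZMod.isUnit_natCast_iff_not_dvd_pow`
and core `Nat.pow_dvd_pow_iff_le_right` are used. References: `R1-DEPTH-LAW.md` §2; B. Mazur, K. Rubin,
*Kolyvagin systems*, Mem. AMS 799 (2004), Thm. 5.2.12 [MazurRubin2004]; C.-H. Kim, Amer. J. Math. 148 (2026)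
= arXiv:2203.12159, Thm. 3.13, (5.3) [Kim2022StructureSelmer]; J. Neukirch, A. Schmidt, K. Wingberg,
*Cohomology of Number Fields*, (8.1.17) (reciprocity for `Br`); hyp `SHARPENED-CONJECTURES.md` §120.
-/

noncomputable section

open scoped Classical MatrixGroups ModularForm

open CongruenceSubgroup WeierstrassCurve Literature.NumberTheory.EllipticCurves
  Literature.NumberTheory.EllipticCurves.Rank1Residual

namespace Summit.BirchSwinnertonDyer.Rank1Residual.Ordinary

/-! ### §1 `ord_p` of powers of `p`, of products, of negatives -/

section OrdArithmetic

variable {p : ℕ}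

/-- `ord_p(p^a mod p^n) = min(n, a)`. [folklore] -/
theorem zmodPowOrd_natCast_pow (hp : p.Prime) (n a : ℕ) :
    zmodPowOrd p n ((p ^ a : ℕ) : ZMod (p ^ n)) = min n a := by
  rcases le_or_gt n a with hna | han
  · have h0 : ((p ^ a : ℕ) : ZMod (p ^ n)) = 0 :=
      (ZMod.natCast_eq_zero_iff _ _).mpr (pow_dvd_pow p hna)
    rw [h0, zmodPowOrd_zero, min_eq_left hna]
  · haveI : NeZero (p ^ n) := ⟨pow_ne_zero n hp.ne_zero⟩
    have hval : ((p ^ a : ℕ) : ZMod (p ^ n)).val = p ^ a := by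
      rw [ZMod.val_natCast, Nat.mod_eq_of_lt (Nat.pow_lt_pow_right hp.one_lt han)]
    rw [min_eq_right han.le]
    apply le_antisymm
    · by_contra h
      have h1 : a + 1 ≤ zmodPowOrd p n ((p ^ a : ℕ) : ZMod (p ^ n)) := by omega
      rw [le_zmodPowOrd_iff_dvd_val hp (by omega) _, hval,
        Nat.pow_dvd_pow_iff_le_right hp.one_lt] at h1
      omega
    · rw [le_zmodPowOrd_iff_dvd_val hp han.le, hval]

/-- **`ord_p` of a product**: `ord_p(x·y) = min(n, ord_p x + ord_p y)` in `ℤ/p^n` (`p` prime): below the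
cap `ord_p` is the `p`-adic valuation of the representative and valuations add; at the cap the product
vanishes. The arithmetic behind "a perfect pairing of classes of exponents `i` and `j` has value of exponent
`min(k′, i + j)`" in `R1-DEPTH-LAW.md` §2 (iii). [folklore] -/
theorem zmodPowOrd_mul (hp : p.Prime) {n : ℕ} (x y : ZMod (p ^ n)) :
    zmodPowOrd p n (x * y) = min n (zmodPowOrd p n x + zmodPowOrd p n y) := by
  haveI : NeZero (p ^ n) := ⟨pow_ne_zero n hp.ne_zero⟩
  haveI : Fact p.Prime := ⟨hp⟩
  by_cases hx : x = 0
  · subst hx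
    rw [zero_mul, zmodPowOrd_zero, min_eq_left (Nat.le_add_right _ _)]
  by_cases hy : y = 0
  · subst hy
    rw [mul_zero, zmodPowOrd_zero, min_eq_left (Nat.le_add_left _ _)]
  have hxv : x.val ≠ 0 := fun h => hx ((ZMod.val_eq_zero x).mp h)
  have hyv : y.val ≠ 0 := fun h => hy ((ZMod.val_eq_zero y).mp h)
  -- for `m ≤ n`: `m ≤ ord(xy) ↔ p^m ∣ x.val * y.val ↔ m ≤ ord x + ord y`
  have key : ∀ m ≤ n,
      (m ≤ zmodPowOrd p n (x * y) ↔ m ≤ zmodPowOrd p n x + zmodPowOrd p n y) := by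
    intro m hm
    rw [le_zmodPowOrd_iff_dvd_val hp hm, ZMod.val_mul, Nat.dvd_mod_iff (pow_dvd_pow p hm),
      zmodPowOrd_of_ne_zero hx, zmodPowOrd_of_ne_zero hy, ← padicValNat.mul hxv hyv,
      padicValNat_dvd_iff_le (mul_ne_zero hxv hyv)]
  apply le_antisymm
  · have h1 := zmodPowOrd_le hp (x * y)
    exact le_min h1 ((key _ h1).mp le_rfl)
  · rcases le_total n (zmodPowOrd p n x + zmodPowOrd p n y) with h | h
    · rw [min_eq_left h]
      exact (key n le_rfl).mpr h
    · rw [min_eq_right h]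
      exact (key _ h).mpr le_rfl

/-- `ord_p(p^a · x) = min(n, a + ord_p x)`. [folklore] -/
theorem zmodPowOrd_natCast_pow_mul (hp : p.Prime) {n : ℕ} (a : ℕ) (x : ZMod (p ^ n)) :
    zmodPowOrd p n ((p ^ a : ℕ) * x) = min n (a + zmodPowOrd p n x) := by
  rw [zmodPowOrd_mul hp, zmodPowOrd_natCast_pow hp]
  have := zmodPowOrd_le hp x
  omega

/-- `ord_p(−x) = ord_p(x)`. [folklore] -/
theorem zmodPowOrd_neg (hp : p.Prime) {n : ℕ} (x : ZMod (p ^ n)) :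
    zmodPowOrd p n (-x) = zmodPowOrd p n x := by
  rw [← neg_one_mul]
  exact zmodPowOrd_mul_of_isUnit hp isUnit_one.neg x

end OrdArithmetic

/-! ### §2 Biadditive pairings on `ℤ/p^n`: shape, perfectness, `ord_p` of values -/

section Pairings

variable {p : ℕ}

/-- **Every biadditive pairing `B : ℤ/q × ℤ/q → ℤ/q` is `B(x, y) = x·y·B(1, 1)`** (`ℤ/q` is cyclic, generated
by `1`). In `R1-DEPTH-LAW.md` §2 (iii) the local cup-product pairings `H¹_s × H¹_f → ℤ/p^{k′}` at `ℓ` and at `p`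
are biadditive maps between rank-one free `ℤ/p^{k′}`-modules; after choosing generators they have this shape.
[folklore] -/
theorem biadditive_apply_eq {q : ℕ} [NeZero q] (B : ZMod q →+ ZMod q →+ ZMod q) (x y : ZMod q) :
    B x y = x * y * B 1 1 := by
  have hx : x = x.val • (1 : ZMod q) := by rw [nsmul_eq_mul, mul_one, ZMod.natCast_zmod_val]
  have hy : y = y.val • (1 : ZMod q) := by rw [nsmul_eq_mul, mul_one, ZMod.natCast_zmod_val]
  have h1 : B x y = y.val • B x 1 := by
    conv_lhs => rw [hy]
    exact map_nsmul (B x) _ _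
  have h2 : B x 1 = x.val • B 1 1 := by
    have h := map_nsmul (B.flip 1) x.val (1 : ZMod q)
    rw [AddMonoidHom.flip_apply, AddMonoidHom.flip_apply, ← hx] at h
    exact h
  rw [h1, h2, nsmul_eq_mul, nsmul_eq_mul, ZMod.natCast_zmod_val, ZMod.natCast_zmod_val]
  ring

/-- **Perfectness on `ℤ/p^n` (`n ≥ 1`) is `B(1,1) ∈ (ℤ/p^n)ˣ`**: a biadditive pairing
`B : ℤ/p^n × ℤ/p^n → ℤ/p^n` is left-non-degenerate (`B(x, ·) = 0 ⇒ x = 0`) iff `B(1, 1)` is a unit (then it is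
also right-non-degenerate and induces `ℤ/p^n ≅ Hom(ℤ/p^n, ℤ/p^n)`; if `p ∣ B(1,1)` the class `p^{n−1} ≠ 0` pairs
to zero with everything). This is the sense in which the hypotheses `IsUnit (B 1 1)` of §3 say "perfect
pairing" (local Tate duality between `H¹_f` and `H¹_s` at a Kolyvagin prime, resp. at `p`). [folklore] -/
theorem isUnit_apply_one_iff_nondegenerate (hp : p.Prime) {n : ℕ} (hn : 1 ≤ n)
    (B : ZMod (p ^ n) →+ ZMod (p ^ n) →+ ZMod (p ^ n)) :
    IsUnit (B 1 1) ↔ ∀ x, (∀ y, B x y = 0) → x = 0 := by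
  haveI : NeZero (p ^ n) := ⟨pow_ne_zero n hp.ne_zero⟩
  constructor
  · intro hu x hx
    have h := hx 1
    rw [biadditive_apply_eq, mul_one] at h
    exact hu.mul_left_eq_zero.mp h
  · intro hnd
    by_contra hu
    have hc : ((B 1 1).val : ZMod (p ^ n)) = B 1 1 := ZMod.natCast_zmod_val _
    have hdvd : p ∣ (B 1 1).val := by
      by_contra hnd'
      exact hu (hc ▸ (ZMod.isUnit_natCast_iff_not_dvd_pow hp hn).mpr hnd')
    have hx0 : ((p ^ (n - 1) : ℕ) : ZMod (p ^ n)) ≠ 0 := by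
      rw [ne_eq, ZMod.natCast_eq_zero_iff, Nat.pow_dvd_pow_iff_le_right hp.one_lt]
      omega
    refine hx0 (hnd _ fun y => ?_)
    obtain ⟨d, hd⟩ := hdvd
    rw [biadditive_apply_eq, ← hc, hd, Nat.cast_mul,
      show ((p ^ (n - 1) : ℕ) : ZMod (p ^ n)) * y * ((p : ZMod (p ^ n)) * d)
        = ((p ^ (n - 1) * p : ℕ) : ZMod (p ^ n)) * (y * d) by push_cast; ring,
      ← pow_succ, Nat.sub_add_cancel hn, ZMod.natCast_self, zero_mul]

/-- **`ord_p` of a perfect pairing value**: `ord_p B(x, y) = min(n, ord_p x + ord_p y)` when `B(1,1)` is a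
unit. [folklore] -/
theorem zmodPowOrd_biadditive (hp : p.Prime) {n : ℕ} (B : ZMod (p ^ n) →+ ZMod (p ^ n) →+ ZMod (p ^ n))
    (hB : IsUnit (B 1 1)) (x y : ZMod (p ^ n)) :
    zmodPowOrd p n (B x y) = min n (zmodPowOrd p n x + zmodPowOrd p n y) := by
  haveI : NeZero (p ^ n) := ⟨pow_ne_zero n hp.ne_zero⟩
  rw [biadditive_apply_eq, mul_comm, zmodPowOrd_mul_of_isUnit hp hB, zmodPowOrd_mul hp]

end Pairings

/-! ### §3 The reciprocity skeleton -/

section Skeleton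

variable {p : ℕ}

/-- **THE RECIPROCITY SKELETON of `R1-DEPTH-LAW.md` §2 (iii).** In `ℤ/p^n` (`n = k′_ℓ`) let
* `xl` = the singular part of `κ_ℓ` at `ℓ` in `H¹_s(ℚ_ℓ, W) ≅ ℤ/p^n`, of `ord_p = min(n, a + v)` (input (ii):
  the Kolyvagin-system axiom transports `loc_ℓ κ₁ = p^a·u·P̄`, and `P̄` has divisibility exponent `v = v_ℓ(P)`
  in `Ẽ(𝔽_ℓ)/p^n` — `Ordinary/CyclicSylowClassExponent.lean`);
* `yl` = `P̄ ∈ H¹_f(ℚ_ℓ, W) = Ẽ(𝔽_ℓ)/p^n ≅ ℤ/p^n`, of `ord_p = min(n, v)`;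
* `yp` = `P ∈ H¹_f(ℚ_p, W) = E(ℚ_p)/p^n ≅ ℤ/p^n`, of `ord_p = min(n, m)`, `m = m_p`
  (`Ordinary/LocalPointsModPrimePower.lean`);
* `xp` = `loc^s_p κ_ℓ ∈ H¹_s(ℚ_p, W) ≅ ℤ/p^n`, `s := ord_p xp` (the number Kim's Thm. 3.13 reads);
* `Bl`, `Bp` = the local cup-product pairings at `ℓ` and at `p`, PERFECT (`B(1,1)` a unit, §2);
* reciprocity `Σ_w inv_w(κ_ℓ ∪ P) = 0` with only `w ∈ {ℓ, p}` contributing: `Bl(xl, yl) + Bp(xp, yp) = 0`.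
Then **`min(n, a + 2·v) = min(n, s + m)`**. WHY TWO: `v` is counted once inside `xl` and once in `yl`.
Pure arithmetic in `ℤ/p^n` (§1–§2); every cohomological statement above is a HYPOTHESIS, none is asserted.
[cite: MazurRubin2004, Thm. 5.2.12; Kim2022StructureSelmer, Thm. 3.13] -/
theorem min_eq_min_of_reciprocity (hp : p.Prime) {n : ℕ}
    (Bl Bp : ZMod (p ^ n) →+ ZMod (p ^ n) →+ ZMod (p ^ n)) (hBl : IsUnit (Bl 1 1))
    (hBp : IsUnit (Bp 1 1)) {xl yl xp yp : ZMod (p ^ n)} {a v m : ℕ}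
    (hxl : zmodPowOrd p n xl = min n (a + v)) (hyl : zmodPowOrd p n yl = min n v)
    (hyp : zmodPowOrd p n yp = min n m) (hrec : Bl xl yl + Bp xp yp = 0) :
    min n (a + 2 * v) = min n (zmodPowOrd p n xp + m) := by
  have h1 : Bl xl yl = -(Bp xp yp) := eq_neg_of_add_eq_zero_left hrec
  have h2 : zmodPowOrd p n (Bl xl yl) = zmodPowOrd p n (Bp xp yp) := by
    rw [h1, zmodPowOrd_neg hp]
  rw [zmodPowOrd_biadditive hp Bl hBl, zmodPowOrd_biadditive hp Bp hBp, hxl, hyl, hyp] at h2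
  have hs := zmodPowOrd_le hp xp
  omega

end Skeleton

/-! ### §4 With the Mazur–Rubin input `a = m + F`: the derived regime and its complement -/

section Consequences

variable {p : ℕ} {n : ℕ} (hp : p.Prime)
  (Bl Bp : ZMod (p ^ n) →+ ZMod (p ^ n) →+ ZMod (p ^ n)) (hBl : IsUnit (Bl 1 1))
  (hBp : IsUnit (Bp 1 1)) {xl yl xp yp : ZMod (p ^ n)} {a v m F : ℕ}
  (hxl : zmodPowOrd p n xl = min n (a + v)) (hyl : zmodPowOrd p n yl = min n v)
  (hyp : zmodPowOrd p n yp = min n m) (hrec : Bl xl yl + Bp xp yp = 0) (ha : a = m + F)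

include hp hBl hBp hxl hyl hyp hrec ha

/-- **The unconditional bound**: `min(n, m + F + 2v) ≤ s + m` — outside the derived regime the skeleton
still gives `s ≥ k′ − m_p` (`R1-DEPTH-LAW.md` §2: "the derivation gives `ord ≥ k′ − m_p` only").
[cite: MazurRubin2004, Thm. 5.2.12] -/
theorem min_le_singularOrder_add : min n (m + F + 2 * v) ≤ zmodPowOrd p n xp + m := by
  have h := min_eq_min_of_reciprocity hp Bl Bp hBl hBp hxl hyl hyp hrec
  subst ha
  omega

/-- **The derived regime, uncapped case**: if `m + F + 2v < n` then **`s = F + 2v`** exactly (`m_p` enters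
`a` and `inv_p` symmetrically and cancels). [cite: MazurRubin2004, Thm. 5.2.12] -/
theorem singularOrder_eq_of_lt (hlt : m + F + 2 * v < n) : zmodPowOrd p n xp = F + 2 * v := by
  have h := min_eq_min_of_reciprocity hp Bl Bp hBl hBp hxl hyl hyp hrec
  subst ha
  omega

/-- **The derived regime, `m_p = 0` case**: if `m = 0` then `min(k, s) = min(k, F + 2v)` for EVERY `k ≤ n`
— LAW-2's right-hand side at every depth read below `k′`. [cite: MazurRubin2004, Thm. 5.2.12] -/
theorem min_singularOrder_eq_of_index_zero (hm : m = 0) {k : ℕ} (hk : k ≤ n) :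
    min k (zmodPowOrd p n xp) = min k (F + 2 * v) := by
  have h := min_eq_min_of_reciprocity hp Bl Bp hBl hBp hxl hyl hyp hrec
  subst ha hm
  omega

/-- The `m_p = 0` case in LEVEL-REDUCED form: `ord_p(xp mod p^k) = min(k, F + 2v)` for every `k ≤ n`
(`zmodPowOrd_castHom`). [cite: MazurRubin2004, Thm. 5.2.12] -/
theorem zmodPowOrd_castHom_singular_eq_of_index_zero (hm : m = 0) {k : ℕ} (hk : k ≤ n) :
    zmodPowOrd p k (ZMod.castHom (pow_dvd_pow p hk) (ZMod (p ^ k)) xp) = min k (F + 2 * v) := by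
  rw [zmodPowOrd_castHom hp hk,
    min_singularOrder_eq_of_index_zero hp Bl Bp hBl hBp hxl hyl hyp hrec ha hm hk]

/-- **The dichotomy**: either `s = F + 2v` (the law), or the level is too shallow for the `m_p`-shifted
exponent — `n ≤ m + F + 2v` — and then only `n ≤ s + m` is forced. This is the exact content of
`R1-DEPTH-LAW.md` §2's "DERIVED when `m_p = 0` or `FLOOR + m_p + 2v < k′`" and of the regime that part (C)
of P-5 ROUND 10 read empirically (`74 / 74` for the free form there — NOT a consequence of the skeleton).
[cite: MazurRubin2004, Thm. 5.2.12] -/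
theorem singularOrder_dichotomy :
    zmodPowOrd p n xp = F + 2 * v ∨ (n ≤ m + F + 2 * v ∧ n ≤ zmodPowOrd p n xp + m) := by
  have h := min_eq_min_of_reciprocity hp Bl Bp hBl hBp hxl hyl hyp hrec
  subst ha
  omega

/-- In the derived regime (`m = 0 ∨ m + F + 2v < n`) the depth-`k` reading is the law's right-hand side:
`min(k, s) = min(k, F + 2v)` for every `k ≤ n`. [cite: MazurRubin2004, Thm. 5.2.12] -/
theorem min_singularOrder_eq_of_derived (hreg : m = 0 ∨ m + F + 2 * v < n) {k : ℕ} (hk : k ≤ n) :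
    min k (zmodPowOrd p n xp) = min k (F + 2 * v) := by
  rcases hreg with hm | hlt
  · exact min_singularOrder_eq_of_index_zero hp Bl Bp hBl hBp hxl hyl hyp hrec ha hm hk
  · rw [singularOrder_eq_of_lt hp Bl Bp hBl hBp hxl hyl hyp hrec ha hlt]

end Consequences

/-! ### §5 Consumer: C-16's clause at `(ℓ, k)` from the skeleton data as hypotheses -/

section Consumer

variable (W : WeierstrassCurve ℚ) [W.IsGloballyMinimal] {N : ℕ} (f : CuspForm (Gamma0 N) 2)
  (ℓ : ℕ) [Fact ℓ.Prime] (k : ℕ) (P : W.toAffine.Point) (F : ℕ)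

/-- **C-16 at a level FROM ITS DERIVATION'S INPUTS (as hypotheses).** Suppose that for every surjective
family of discrete logarithms `ψ` at level `3^k` there exist a depth `n ≥ k` (`n = k′_ℓ`), two perfect
biadditive pairings `Bl`, `Bp` on `ℤ/3^n`, elements `xl yl xp yp ∈ ℤ/3^n` and exponents `a`, `m` with
`ord xl = min(n, a + v)`, `ord yl = min(n, v)`, `ord yp = min(n, m)` where `v = localDivExponent W 3 ℓ P`
(= `v_ℓ(P)`, C-16's vocabulary), reciprocity `Bl(xl,yl) + Bp(xp,yp) = 0`, the Mazur–Rubin input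
`a = m + F`, the regime `m = 0 ∨ m + F + 2v < n` (C-16's letter has `m₃(P) = 0`), and the Kim-Thm-3.13-shaped
identification **`ord₃(δ̃_ℓ mod 3^k) = min(k, ord xp)`** (`t = 0`). Then `KuriharaExactOrderAt W f ℓ k P F`:
`ord₃(δ̃_ℓ mod 3^k) = min(k, F + 2·v_ℓ(P))` for every such `ψ`. Nothing is asserted — the hypothesis is
precisely what the cohomological layer absent from the tree (Kato's Kolyvagin system, Mazur–Rubin 5.2.12,
the Kolyvagin-system axiom and local duality at `ℓ` and `p`, reciprocity for `Br ℚ`, Kim Thm. 3.13 at `p = 3`)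
would have to deliver per level; C-16 stays OPEN. [cite: Kim2022StructureSelmer, Thm. 3.13 and (5.3);
MazurRubin2004, Thm. 5.2.12] -/
theorem kuriharaExactOrderAt_of_reciprocitySkeleton
    (h : ∀ ψ : (q : ℕ) → (ZMod q)ˣ →* Multiplicative (ZMod (3 ^ k)),
      (∀ q ∈ ℓ.primeFactors, Function.Surjective (ψ q)) →
        ∃ (n : ℕ) (_ : k ≤ n) (Bl Bp : ZMod (3 ^ n) →+ ZMod (3 ^ n) →+ ZMod (3 ^ n))
          (xl yl xp yp : ZMod (3 ^ n)) (a m : ℕ),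
          IsUnit (Bl 1 1) ∧ IsUnit (Bp 1 1) ∧
          zmodPowOrd 3 n xl = min n (a + localDivExponent W 3 ℓ P) ∧
          zmodPowOrd 3 n yl = min n (localDivExponent W 3 ℓ P) ∧
          zmodPowOrd 3 n yp = min n m ∧
          Bl xl yl + Bp xp yp = 0 ∧ a = m + F ∧
          (m = 0 ∨ m + F + 2 * localDivExponent W 3 ℓ P < n) ∧
          (haveI : NeZero ℓ := ⟨(Fact.out : ℓ.Prime).ne_zero⟩
           zmodPowOrd 3 k (kuriharaNumber f (3 ^ k) ℓ ψ) = min k (zmodPowOrd 3 n xp))) :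
    KuriharaExactOrderAt W f ℓ k P F := by
  haveI : NeZero ℓ := ⟨(Fact.out : ℓ.Prime).ne_zero⟩
  intro ψ hψ
  obtain ⟨n, hk, Bl, Bp, xl, yl, xp, yp, a, m, hBl, hBp, hxl, hyl, hyp, hrec, ha, hreg, hkim⟩ := h ψ hψ
  rw [hkim]
  exact min_singularOrder_eq_of_derived Nat.prime_three Bl Bp hBl hBp hxl hyl hyp hrec ha hreg hk

end Consumer

end Summit.BirchSwinnertonDyer.Rank1Residual.Ordinary

end

/-! ### §6 Sharpness: outside the derived regime the skeleton does NOT force the law -/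

namespace Summit.BirchSwinnertonDyer.Rank1Residual.Ordinary

section Sharpness

/-- **The dichotomy of §4 is sharp.** At depth `n = 2` with `m = 1`, `F = 0`, `v = 1` (`n ≤ m + F + 2v`,
outside the derived regime) the data `xl = 0`, `yl = yp = xp = p`, both pairings = multiplication satisfy
EVERY hypothesis of the skeleton (`a = m + F = 1`; reciprocity `0·p + p·p = 0`), yet `s = ord xp = 1 ≠
F + 2v = 2`: the «free form» of LAW-2 on the `m_p ≥ 1` strata (C-17 = C120.2; P-5 ROUND 10 part (C), `74 / 74`
where `m₃ + 2v ≥ k′`) is NOT a consequence of the reciprocity skeleton — it is extra-skeletal information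
(R1-DEPTH-LAW §2, last paragraph: the `p`-singular class `c`). Nothing asserted about any curve. [folklore] -/
theorem exists_skeleton_singularOrder_ne {p : ℕ} (hp : p.Prime) :
    ∃ (Bl Bp : ZMod (p ^ 2) →+ ZMod (p ^ 2) →+ ZMod (p ^ 2)) (xl yl xp yp : ZMod (p ^ 2))
      (a v m F : ℕ),
      IsUnit (Bl 1 1) ∧ IsUnit (Bp 1 1) ∧
      zmodPowOrd p 2 xl = min 2 (a + v) ∧ zmodPowOrd p 2 yl = min 2 v ∧
      zmodPowOrd p 2 yp = min 2 m ∧ Bl xl yl + Bp xp yp = 0 ∧ a = m + F ∧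
      2 ≤ m + F + 2 * v ∧ zmodPowOrd p 2 xp ≠ F + 2 * v := by
  have hordp : zmodPowOrd p 2 ((p : ℕ) : ZMod (p ^ 2)) = 1 := by
    have h := zmodPowOrd_natCast_pow hp 2 1
    rwa [pow_one] at h
  have hpp : ((p : ℕ) : ZMod (p ^ 2)) * p = 0 := by
    rw [← Nat.cast_mul, ← pow_two, ZMod.natCast_self]
  refine ⟨AddMonoidHom.mul, AddMonoidHom.mul, 0, p, p, p, 1, 1, 1, 0, ?_, ?_, ?_, ?_, ?_, ?_, rfl,
    by norm_num, ?_⟩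
  · rw [AddMonoidHom.mul_apply, mul_one]
    exact isUnit_one
  · rw [AddMonoidHom.mul_apply, mul_one]
    exact isUnit_one
  · rw [zmodPowOrd_zero]; decide
  · rw [hordp]; decide
  · rw [hordp]; decide
  · rw [AddMonoidHom.mul_apply, AddMonoidHom.mul_apply, zero_mul, zero_add, hpp]
  · rw [hordp]
    omega

end Sharpness

end Summit.BirchSwinnertonDyer.Rank1Residual.Ordinary
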